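import Mathlib
import Summits.AtomisticToContinuum.Crystallization.Theses.PhononSlackCertificates

/-!
# Route `PhononSlackCertificates`, crux `NearFieldConvexity` (stmt-AtomisticToContinuum-13958), line `Sketch`:
stub `stub_barrierTwoBlocks`

Barrier below the first pivot + PSD barrier Schur complement => PSD block matrix (card hagg-word-riccati-barriers).
-/

noncomputable section

open scoped BigOperators InnerProductSpace Matrix ComplexOrder
open Literature.MathematicalPhysics.StatisticalMechanics Literature.Geometry.DiscreteGeometry

namespace Summit.AtomisticToContinuum.Crystallization.Theorems.PhononSlackNearFieldConvexity

/-- **Stub (card B): barrier ⇒ positivity, two-block case.** If a positive definite barrier `X` sits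
below the first pivot (`A − X ⪰ 0`) and the barrier Schur complement `D − Bᴴ X⁻¹ B` is positive
semidefinite, then `[[A, B], [Bᴴ, D]] ⪰ 0` (Hermitian-ness of `A`, `D` follows from the hypotheses). -/
theorem stub_barrierTwoBlocks {m k : ℕ} (A X : Matrix (Fin m) (Fin m) ℂ) (B : Matrix (Fin m) (Fin k) ℂ)
    (D : Matrix (Fin k) (Fin k) ℂ) (hX : X.PosDef) (hXA : (A - X).PosSemidef)
    (hS : (D - Bᴴ * X⁻¹ * B).PosSemidef) :
    (Matrix.fromBlocks A B Bᴴ D).PosSemidef := by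
  -- (1) the barrier block matrix `[[X, B], [Bᴴ, D]]` is PSD by Mathlib's Schur-complement
  -- criterion `Matrix.PosDef.fromBlocks₁₁` (pivot `X ≻ 0`, Schur complement `hS`).
  have h1 : (Matrix.fromBlocks X B Bᴴ D).PosSemidef := by
    letI : Invertible X := hX.isUnit.invertible
    exact (Matrix.PosDef.fromBlocks₁₁ B D hX).mpr hS
  -- (2) the slack `[[A - X, 0], [0, 0]] = Pᴴ (A - X) P` with `P = [1 | 0]` is PSD.
  have h2 : (Matrix.fromBlocks (A - X) 0 0 0 :
      Matrix (Fin m ⊕ Fin k) (Fin m ⊕ Fin k) ℂ).PosSemidef := by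
    have h := hXA.conjTranspose_mul_mul_same
      (Matrix.fromCols (1 : Matrix (Fin m) (Fin m) ℂ) (0 : Matrix (Fin m) (Fin k) ℂ))
    rwa [Matrix.conjTranspose_fromCols_eq_fromRows_conjTranspose, Matrix.fromRows_mul,
      Matrix.fromRows_mul_fromCols, Matrix.conjTranspose_one, Matrix.conjTranspose_zero,
      Matrix.one_mul, Matrix.zero_mul, Matrix.mul_one, Matrix.mul_zero, Matrix.zero_mul,
      Matrix.zero_mul] at h
  -- (3) `[[A, B], [Bᴴ, D]] = [[X, B], [Bᴴ, D]] + [[A - X, 0], [0, 0]]`.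
  have e : Matrix.fromBlocks A B Bᴴ D =
      Matrix.fromBlocks X B Bᴴ D + Matrix.fromBlocks (A - X) 0 0 0 := by
    rw [Matrix.fromBlocks_add, add_sub_cancel, add_zero, add_zero, add_zero]
  rw [e]
  exact h1.add h2

end Summit.AtomisticToContinuum.Crystallization.Theorems.PhononSlackNearFieldConvexity
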